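import Summits.AtomisticToContinuum.BoseEinsteinCondensation.Theses.BECInsertionCorrector
import Summits.AtomisticToContinuum.BoseEinsteinCondensation.Theorems.StaticResponseBound.Negative.Basic
import Literature.MathematicalPhysics.QuantumManyBody.BoseGasStructureFactor
import Literature.MathematicalPhysics.QuantumManyBody.PeriodicBoseGasMomentumSector
import Summits.AtomisticToContinuum.BoseEinsteinCondensation.Theorems.BECInsertionCorrectorStaticResponseBoundFreeSquare
import HarnessLib

/-!
# Window assembly for the static response bound (stub C3 of line `stable-fraction-square-completion`)

Helper file for the crux `BECInsertionCorrector.StaticResponseBound` (item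
stmt-AtomisticToContinuum-12057; this file supports, does not close, the item), line
`stable-fraction-square-completion`, registered stub **C3** `stub_windowAssembly`.

The line reduces the crux on the phonon + crossover window `|p|² ≤ M₀² ρa` (`p = 2πk/L`,
`L = (N/ρ)^{1/3}`, `a` the scattering length) to three analytic inputs:

* the ENERGY-CONTROLLED STRUCTURE FACTOR (ECSF): constants `(ρ₀, θ, C_H)` with
  `λ ⟨|ρ̂_p|²⟩_Φ ≤ (E_Φ − E₀) + λ C_H N |p|/√(ρa)`, `λ = θ(8πa + |p|²/(2ρ))/L³`, for every finite-energy `Φ`;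
* the SECTOR FLOOR: constants `(θ_L, ρ₀′)` with `E₀ + θ_L √(ρa) min(|2πm/L|, M₀√(ρa)) ≤ E₀(sector 2πm/L)`
  for every `m ≠ 0`;
* the SECTOR CAUCHY–SCHWARZ reduction: at fixed `(N, L, k)`, an ECSF with constants `(λ, D)` and a floor
  `Δ > 0` on the stiffer member of every sector pair `(q, q + k)` give
  `⟨∑ⱼ cos(p·xⱼ)⟩_Ψ² ≤ 4((1 + D/Δ)/λ)(E_Ψ − E₀)` for every finite-energy `Ψ`.

This file proves the BOOKKEEPING that assembles them into the crux's inner inequality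
`Negative.Ineq v C ρ N k t Ψ` on the window, with `C = 2(1 + K₀)/θ`, `K₀ = 2θ(8π + M₀²/2)C_H/θ_L`:
`L³ = N/ρ` turns `λ` into `θ(8πρa + |p|²/2)/N ≥ θ max(ρa,|p|²)/(2N)`; with `Δ = θ_L√(ρa)|p|/2` one has
`D/Δ = 2θ(8πρa + |p|²/2)C_H/(θ_L ρa) ≤ K₀` inside the window; the triangle inequality on lattice momenta
`|p| ≤ |2πq/L| + |2π(q+k)/L|` shows that one member of each pair carries at least `|p|/2`, so the sector
floor (with `|p| ≤ M₀√(ρa)`) supplies `Δ`; finally the discriminant in `t`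
(`Negative.forall_ineq_iff_discriminant`) converts the susceptibility bound into `Ineq`.

Contents: lattice-momentum lemmas `wa_norm_latticeMomentum`, `wa_latticeMomentum_add`,
`wa_sqrt_psq_le_add`, `wa_half_le_or`, `wa_ne_zero_of_sqrt_psq_pos`; the pure real-variable
coefficient bound `wa_coeff_le`; and the registered stub `stub_windowAssembly` (statement verbatim
from the checked skeleton `Cruxes/StaticResponseBound/Lines/stable-fraction-square-completion.lean`).
Reused from the tree: `UvThomsonForceWave.freeSq_psq_pos` (`|p|² > 0`), `div_sideLength_pow_three`
(`L³ = N/ρ`), `Negative.forall_ineq_iff_discriminant`.  No new definitions; all ingredients are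
folklore real analysis.
-/

namespace Summit.AtomisticToContinuum.BoseEinsteinCondensation.Cruxes.StaticResponseBound.StableFractionSquareCompletion

open MeasureTheory
open scoped ENNReal ComplexConjugate
open Literature.MathematicalPhysics.QuantumManyBody.BoseGas
open Summit.AtomisticToContinuum.BoseEinsteinCondensation.Theses
open Summit.AtomisticToContinuum.BoseEinsteinCondensation.Theorems.StaticResponseBound.Negative

noncomputable section

/-! ## Lattice momenta `p = 2πm/L` -/

/-- A mode with `√(|2πm/L|²) > 0` is nonzero (`psq L 0 = 0`). [folklore] -/
theorem wa_ne_zero_of_sqrt_psq_pos {L : ℝ} {m : Fin 3 → ℤ} (h : 0 < Real.sqrt (psq L m)) :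
    m ≠ 0 := by
  rintro rfl
  simp [psq] at h

/-- The norm of the lattice momentum `(2π/L) m ∈ ℝ³` is `√(psq L m)` (`L > 0`). [folklore] -/
theorem wa_norm_latticeMomentum {L : ℝ} (hL : 0 < L) (m : Fin 3 → ℤ) :
    ‖(2 * Real.pi / L) • (WithLp.toLp 2 fun t => (m t : ℝ) : EuclideanSpace ℝ (Fin 3))‖ =
      Real.sqrt (psq L m) := by
  have hc : 0 ≤ 2 * Real.pi / L := by positivity
  have hsum : ∑ i, ‖(WithLp.toLp 2 fun t => (m t : ℝ) : EuclideanSpace ℝ (Fin 3)) i‖ ^ 2 =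
      ∑ i, (m i : ℝ) ^ 2 :=
    Finset.sum_congr rfl fun i _ => by simp
  rw [norm_smul, Real.norm_of_nonneg hc, EuclideanSpace.norm_eq, hsum, psq,
    Real.sqrt_mul' _ (Finset.sum_nonneg fun i _ => sq_nonneg _), Real.sqrt_sq hc]

/-- Linearity of `m ↦ (2π/L) m`: the momentum of `q + k` is the sum of the momenta. [folklore] -/
theorem wa_latticeMomentum_add (L : ℝ) (q k : Fin 3 → ℤ) :
    ((2 * Real.pi / L) • (WithLp.toLp 2 fun t => ((q + k) t : ℝ)) : EuclideanSpace ℝ (Fin 3)) =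
      (2 * Real.pi / L) • (WithLp.toLp 2 fun t => (q t : ℝ) : EuclideanSpace ℝ (Fin 3)) +
        (2 * Real.pi / L) • (WithLp.toLp 2 fun t => (k t : ℝ) : EuclideanSpace ℝ (Fin 3)) := by
  ext t
  simp [mul_add]

/-- Triangle inequality on lattice momenta: `|p_k| ≤ |p_q| + |p_{q+k}|`. [folklore] -/
theorem wa_sqrt_psq_le_add {L : ℝ} (hL : 0 < L) (q k : Fin 3 → ℤ) :
    Real.sqrt (psq L k) ≤ Real.sqrt (psq L q) + Real.sqrt (psq L (q + k)) := by
  rw [← wa_norm_latticeMomentum hL k, ← wa_norm_latticeMomentum hL q,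
    ← wa_norm_latticeMomentum hL (q + k), wa_latticeMomentum_add]
  set A := ((2 * Real.pi / L) • (WithLp.toLp 2 fun t => (q t : ℝ)) : EuclideanSpace ℝ (Fin 3))
  set B := ((2 * Real.pi / L) • (WithLp.toLp 2 fun t => (k t : ℝ)) : EuclideanSpace ℝ (Fin 3))
  calc ‖B‖ = ‖(A + B) - A‖ := by rw [add_sub_cancel_left]
    _ ≤ ‖A + B‖ + ‖A‖ := norm_sub_le _ _
    _ = ‖A‖ + ‖A + B‖ := add_comm _ _

/-- Hence one member of each sector pair `(q, q + k)` carries at least half of `|p_k|`. [folklore] -/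
theorem wa_half_le_or {L : ℝ} (hL : 0 < L) (q k : Fin 3 → ℤ) :
    Real.sqrt (psq L k) / 2 ≤ Real.sqrt (psq L q) ∨
      Real.sqrt (psq L k) / 2 ≤ Real.sqrt (psq L (q + k)) := by
  by_contra h
  obtain ⟨h1, h2⟩ := not_or.mp h
  have := wa_sqrt_psq_le_add hL q k
  linarith [not_le.mp h1, not_le.mp h2]

/-! ## The coefficient bookkeeping -/

/-- **Window bookkeeping** (pure real arithmetic). With `L³ = N/ρ`, `λ = θ(8πa + P/(2ρ))/L³`,
`D = λ · C_H N √P/√(ρa)`, `Δ = θ_L √(ρa) √P/2` and `P ≤ M₀² ρa`, `0 < P`, `0 < ρa`: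
`(1 + D/Δ)/λ ≤ C N / max(ρa, P)` with `C = 2(1 + K₀)/θ`, `K₀ = 2θ(8π + M₀²/2)C_H/θ_L`
(`λ = θ(8πρa + P/2)/N ≥ θ max(ρa,P)/(2N)` and `D/Δ = 2θ(8πρa + P/2)C_H/(θ_L ρa) ≤ K₀`). [folklore] -/
theorem wa_coeff_le {θ θL C_H M₀ ρ a P L Nr : ℝ} (hθ : 0 < θ) (hθL : 0 < θL) (hCH : 0 ≤ C_H)
    (hρ : 0 < ρ) (hρa : 0 < ρ * a) (hP : 0 < P) (hN : 0 < Nr) (hL3 : L ^ 3 = Nr / ρ)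
    (hwin : P ≤ M₀ ^ 2 * (ρ * a)) :
    (1 + θ * (8 * Real.pi * a + P / (2 * ρ)) / L ^ 3 *
            (C_H * Nr * Real.sqrt P / Real.sqrt (ρ * a)) /
          (θL * Real.sqrt (ρ * a) * (Real.sqrt P / 2))) /
        (θ * (8 * Real.pi * a + P / (2 * ρ)) / L ^ 3) ≤
      2 * (1 + 2 * θ * (8 * Real.pi + M₀ ^ 2 / 2) * C_H / θL) / θ * Nr / max (ρ * a) P := by
  have hsa : 0 < Real.sqrt (ρ * a) := Real.sqrt_pos.mpr hρa
  have hsP : 0 < Real.sqrt P := Real.sqrt_pos.mpr hP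
  have hsa2 : Real.sqrt (ρ * a) * Real.sqrt (ρ * a) = ρ * a := Real.mul_self_sqrt hρa.le
  set sa := Real.sqrt (ρ * a) with hsa_def
  set sP := Real.sqrt P with hsP_def
  set κ := 8 * Real.pi + M₀ ^ 2 / 2 with hκ_def
  have hκ : 0 < κ := by positivity
  set X := 8 * Real.pi * (ρ * a) + P / 2 with hX_def
  have hX : 0 < X := by positivity
  have hXle : X ≤ κ * (ρ * a) := by
    rw [hX_def, hκ_def]
    linarith
  -- `λ = θ X / N`
  have hlam : θ * (8 * Real.pi * a + P / (2 * ρ)) / L ^ 3 = θ * X / Nr := by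
    rw [hL3, hX_def]
    field_simp
  rw [hlam]
  have hlam_pos : 0 < θ * X / Nr := by positivity
  -- `D / Δ ≤ K₀`
  have hΔ : 0 < θL * sa * (sP / 2) := by positivity
  have hD : θ * X / Nr * (C_H * Nr * sP / sa) = θ * C_H * sP * X / sa := by
    rw [div_mul_div_comm, div_eq_div_iff (by positivity) (by positivity)]
    ring
  have hR : 2 * θ * κ * C_H / θL * (θL * sa * (sP / 2)) * sa = θ * C_H * sP * (κ * (sa * sa)) := by
    rw [div_mul_eq_mul_div, div_mul_eq_mul_div, div_eq_iff hθL.ne']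
    ring
  have hratio : θ * X / Nr * (C_H * Nr * sP / sa) / (θL * sa * (sP / 2)) ≤ 2 * θ * κ * C_H / θL := by
    rw [div_le_iff₀ hΔ, hD, div_le_iff₀ hsa, hR, hsa2]
    exact mul_le_mul_of_nonneg_left hXle (by positivity)
  have hK : 0 ≤ θ * X / Nr * (C_H * Nr * sP / sa) / (θL * sa * (sP / 2)) := by positivity
  -- `(1 + D/Δ)/λ ≤ C N / max(ρa, P)`
  have hmaxpos : 0 < max (ρ * a) P := lt_max_of_lt_right hP
  rw [div_le_div_iff₀ hlam_pos hmaxpos]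
  have hrhs : 2 * (1 + 2 * θ * κ * C_H / θL) / θ * Nr * (θ * X / Nr) =
      (1 + 2 * θ * κ * C_H / θL) * (2 * X) := by
    field_simp
  rw [hrhs]
  have hmax : max (ρ * a) P ≤ 2 * X := by
    rw [hX_def]
    refine max_le ?_ ?_
    · nlinarith [Real.pi_gt_three]
    · nlinarith [Real.pi_gt_three]
  exact mul_le_mul (by linarith) hmax hmaxpos.le (by positivity)

/-! ## The registered stub C3 -/

/-- **C3 (M)** `stub_windowAssembly` — `EnergyControlledStructureFactor → SectorFloor → SectorCauchySchwarz →
StaticResponseBoundPhonon`: fix `v, M₀`; `(ρ₀, θ, C_H)` from ECSF at `M₀`, `(θ_L, ρ₀′)` from the floor at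
`M₀`; `C := 2(1+K₀)/θ`, `K₀ := 2θ(8π + M₀²/2)C_H/θ_L`.  For `N ≥ 1`, `k ≠ 0` in the window
(`a > 0` there, `L³ = N/ρ`, `λ = θ(8πρa + |p|²/2)/N ≥ θ·max(ρa,|p|²)/(2N)`, `D/Δ ≤ K₀` with
`Δ = θ_L√(ρa)|p|/2`, the floor disjunction from `max(|q|,|q+p|) ≥ |p|/2`), SectorCauchySchwarz and
`Negative.forall_ineq_iff_discriminant` give `Ineq v C ρ N k t Ψ`. [folklore] -/
theorem stub_windowAssembly :
    (∀ v : ℝ → ℝ≥0∞, IsRepulsiveFiniteRange v → ∀ M₀ : ℝ, 0 < M₀ →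
      ∃ ρ₀ : ℝ, 0 < ρ₀ ∧ ∃ θ : ℝ, 0 < θ ∧ ∃ C_H : ℝ, 0 ≤ C_H ∧
        ∀ ρ : ℝ, 0 < ρ → ρ < ρ₀ → ∀ N : ℕ, 0 < N → ∀ k : Fin 3 → ℤ, k ≠ 0 →
          psq (sideLength ρ N) k ≤ M₀ ^ 2 * (ρ * (scatteringLength v).toReal) →
          ∀ Φ : PeriodicTrialState N (sideLength ρ N), periodicEnergy v Φ ≠ ⊤ →
            θ * (8 * Real.pi * (scatteringLength v).toReal + psq (sideLength ρ N) k / (2 * ρ)) /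
                sideLength ρ N ^ 3 *
                (∫ X in cellN N (sideLength ρ N),
                  ‖densityWave N (sideLength ρ N) k X‖ ^ 2 * ‖Φ.ψ X‖ ^ 2) ≤
              (periodicEnergy v Φ).toReal - (periodicGroundStateEnergy v N (sideLength ρ N)).toReal +
                θ * (8 * Real.pi * (scatteringLength v).toReal + psq (sideLength ρ N) k / (2 * ρ)) /
                  sideLength ρ N ^ 3 *
                  (C_H * N * Real.sqrt (psq (sideLength ρ N) k) /
                    Real.sqrt (ρ * (scatteringLength v).toReal))) →
    (∀ v : ℝ → ℝ≥0∞, IsRepulsiveFiniteRange v → ∀ M₀ : ℝ, 0 < M₀ →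
      ∃ θL : ℝ, 0 < θL ∧ ∃ ρ₀ : ℝ, 0 < ρ₀ ∧ ∀ ρ : ℝ, 0 < ρ → ρ < ρ₀ → ∀ N : ℕ, 0 < N →
        ∀ m : Fin 3 → ℤ, m ≠ 0 →
          periodicGroundStateEnergy v N (sideLength ρ N)
              + ENNReal.ofReal (θL * Real.sqrt (ρ * (scatteringLength v).toReal)
                  * min (Real.sqrt (psq (sideLength ρ N) m))
                        (M₀ * Real.sqrt (ρ * (scatteringLength v).toReal)))
            ≤ momentumSectorEnergy v N (sideLength ρ N)
                ((2 * Real.pi / sideLength ρ N) •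
                  (WithLp.toLp 2 fun t => (m t : ℝ) : EuclideanSpace ℝ (Fin 3)))) →
    (∀ (v : ℝ → ℝ≥0∞) (N : ℕ) (L : ℝ), 0 < L → ∀ (k : Fin 3 → ℤ), k ≠ 0 →
      ∀ (lam D Δ : ℝ), 0 < lam → 0 ≤ D → 0 < Δ →
      (∀ Φ : PeriodicTrialState N L, periodicEnergy v Φ ≠ ⊤ →
        lam * ∫ X in cellN N L, ‖densityWave N L k X‖ ^ 2 * ‖Φ.ψ X‖ ^ 2 ≤
          (periodicEnergy v Φ).toReal - (periodicGroundStateEnergy v N L).toReal + D) →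
      (∀ q : Fin 3 → ℤ,
        periodicGroundStateEnergy v N L + ENNReal.ofReal Δ ≤
            momentumSectorEnergy v N L
              ((2 * Real.pi / L) • (WithLp.toLp 2 fun t => (q t : ℝ) : EuclideanSpace ℝ (Fin 3))) ∨
        periodicGroundStateEnergy v N L + ENNReal.ofReal Δ ≤
            momentumSectorEnergy v N L
              ((2 * Real.pi / L) •
                (WithLp.toLp 2 fun t => ((q + k) t : ℝ) : EuclideanSpace ℝ (Fin 3)))) →
      ∀ Ψ : PeriodicTrialState N L, periodicEnergy v Ψ ≠ ⊤ →
        cosMean L k Ψ ^ 2 ≤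
          4 * ((1 + D / Δ) / lam) *
            ((periodicEnergy v Ψ).toReal - (periodicGroundStateEnergy v N L).toReal)) →
    ∀ v : ℝ → ℝ≥0∞, IsRepulsiveFiniteRange v → ∀ M₀ : ℝ, 0 < M₀ →
      ∃ ρ₀ : ℝ, 0 < ρ₀ ∧ ∃ C : ℝ, 0 < C ∧
        ∀ ρ : ℝ, 0 < ρ → ρ < ρ₀ → ∀ N : ℕ, 0 < N → ∀ k : Fin 3 → ℤ, k ≠ 0 →
          psq (sideLength ρ N) k ≤ M₀ ^ 2 * (ρ * (scatteringLength v).toReal) →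
          ∀ t : ℝ, ∀ Ψ : PeriodicTrialState N (sideLength ρ N), periodicEnergy v Ψ ≠ ⊤ →
            Ineq v C ρ N k t Ψ := by
  intro hE hB hCS v hv M₀ hM₀
  obtain ⟨ρ₀, hρ₀, θ, hθ, C_H, hCH, hE'⟩ := hE v hv M₀ hM₀
  obtain ⟨θL, hθL, ρ₀', hρ₀', hB'⟩ := hB v hv M₀ hM₀
  have hCpos : 0 < 2 * (1 + 2 * θ * (8 * Real.pi + M₀ ^ 2 / 2) * C_H / θL) / θ := by positivity
  refine ⟨min ρ₀ ρ₀', lt_min hρ₀ hρ₀', 2 * (1 + 2 * θ * (8 * Real.pi + M₀ ^ 2 / 2) * C_H / θL) / θ,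
    hCpos, ?_⟩
  intro ρ hρ hρlt N hN k hk hwin t Ψ hΨ
  have hρ1 : ρ < ρ₀ := hρlt.trans_le (min_le_left _ _)
  have hρ2 : ρ < ρ₀' := hρlt.trans_le (min_le_right _ _)
  have hL : 0 < sideLength ρ N := sideLength_pos hρ hN
  have hNr : (0 : ℝ) < N := by exact_mod_cast hN
  have hP : 0 < psq (sideLength ρ N) k := UvThomsonForceWave.freeSq_psq_pos hL hk
  have hρa : 0 < ρ * (scatteringLength v).toReal := by
    by_contra h
    nlinarith [sq_nonneg M₀, not_lt.mp h]
  have hL3 : sideLength ρ N ^ 3 = N / ρ := by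
    have h := div_sideLength_pow_three hρ hN
    rw [div_eq_iff (pow_pos hL 3).ne'] at h
    rw [eq_div_iff hρ.ne', h]
    ring
  have hsa : 0 < Real.sqrt (ρ * (scatteringLength v).toReal) := Real.sqrt_pos.mpr hρa
  have hsP : 0 < Real.sqrt (psq (sideLength ρ N) k) := Real.sqrt_pos.mpr hP
  have hsP_le : Real.sqrt (psq (sideLength ρ N) k) ≤
      M₀ * Real.sqrt (ρ * (scatteringLength v).toReal) := by
    rw [Real.sqrt_le_left (by positivity), mul_pow, Real.sq_sqrt hρa.le]
    exact hwin
  -- the floor on the stiffer member of a sector pair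
  have key : ∀ m : Fin 3 → ℤ,
      Real.sqrt (psq (sideLength ρ N) k) / 2 ≤ Real.sqrt (psq (sideLength ρ N) m) →
        periodicGroundStateEnergy v N (sideLength ρ N) +
            ENNReal.ofReal (θL * Real.sqrt (ρ * (scatteringLength v).toReal) *
              (Real.sqrt (psq (sideLength ρ N) k) / 2)) ≤
          momentumSectorEnergy v N (sideLength ρ N)
            ((2 * Real.pi / sideLength ρ N) •
              (WithLp.toLp 2 fun t => (m t : ℝ) : EuclideanSpace ℝ (Fin 3))) := by
    intro m hm
    have hm0 : m ≠ 0 := wa_ne_zero_of_sqrt_psq_pos (lt_of_lt_of_le (by positivity) hm)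
    have hmin : Real.sqrt (psq (sideLength ρ N) k) / 2 ≤
        min (Real.sqrt (psq (sideLength ρ N) m))
          (M₀ * Real.sqrt (ρ * (scatteringLength v).toReal)) :=
      le_min hm (by linarith)
    calc _ ≤ periodicGroundStateEnergy v N (sideLength ρ N) +
          ENNReal.ofReal (θL * Real.sqrt (ρ * (scatteringLength v).toReal) *
            min (Real.sqrt (psq (sideLength ρ N) m))
              (M₀ * Real.sqrt (ρ * (scatteringLength v).toReal))) :=
          add_le_add le_rfl (ENNReal.ofReal_le_ofReal
            (mul_le_mul_of_nonneg_left hmin (by positivity)))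
      _ ≤ _ := hB' ρ hρ hρ2 N hN m hm0
  have hfloor : ∀ q : Fin 3 → ℤ,
      periodicGroundStateEnergy v N (sideLength ρ N) +
            ENNReal.ofReal (θL * Real.sqrt (ρ * (scatteringLength v).toReal) *
              (Real.sqrt (psq (sideLength ρ N) k) / 2)) ≤
          momentumSectorEnergy v N (sideLength ρ N)
            ((2 * Real.pi / sideLength ρ N) •
              (WithLp.toLp 2 fun t => (q t : ℝ) : EuclideanSpace ℝ (Fin 3))) ∨
        periodicGroundStateEnergy v N (sideLength ρ N) +
            ENNReal.ofReal (θL * Real.sqrt (ρ * (scatteringLength v).toReal) *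
              (Real.sqrt (psq (sideLength ρ N) k) / 2)) ≤
          momentumSectorEnergy v N (sideLength ρ N)
            ((2 * Real.pi / sideLength ρ N) •
              (WithLp.toLp 2 fun t => ((q + k) t : ℝ) : EuclideanSpace ℝ (Fin 3))) := by
    intro q
    rcases wa_half_le_or hL q k with h | h
    · exact Or.inl (key q h)
    · exact Or.inr (key (q + k) h)
  -- the sector Cauchy–Schwarz reduction with the ECSF constants
  have hmain := hCS v N (sideLength ρ N) hL k hk
    (θ * (8 * Real.pi * (scatteringLength v).toReal + psq (sideLength ρ N) k / (2 * ρ)) /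
      sideLength ρ N ^ 3)
    (θ * (8 * Real.pi * (scatteringLength v).toReal + psq (sideLength ρ N) k / (2 * ρ)) /
      sideLength ρ N ^ 3 *
      (C_H * N * Real.sqrt (psq (sideLength ρ N) k) /
        Real.sqrt (ρ * (scatteringLength v).toReal)))
    (θL * Real.sqrt (ρ * (scatteringLength v).toReal) * (Real.sqrt (psq (sideLength ρ N) k) / 2))
    (by positivity) (by positivity) (by positivity)
    (fun Φ hΦ => hE' ρ hρ hρ1 N hN k hk hwin Φ hΦ) hfloor Ψ hΨ
  have hcoef := wa_coeff_le (M₀ := M₀) hθ hθL hCH hρ hρa hP hNr hL3 hwin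
  have hgap : 0 ≤ (periodicEnergy v Ψ).toReal -
      (periodicGroundStateEnergy v N (sideLength ρ N)).toReal :=
    sub_nonneg.mpr (ENNReal.toReal_mono hΨ (periodicGroundStateEnergy_le v Ψ))
  have hmax : 0 < max (ρ * (scatteringLength v).toReal) (psq (sideLength ρ N) k) :=
    lt_max_of_lt_right hP
  refine (forall_ineq_iff_discriminant v k Ψ hCpos hN hmax).mpr ?_ t
  exact hmain.trans (mul_le_mul_of_nonneg_right
    (mul_le_mul_of_nonneg_left hcoef (by norm_num)) hgap)

end

end Summit.AtomisticToContinuum.BoseEinsteinCondensation.Cruxes.StaticResponseBound.StableFractionSquareCompletion
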